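import Mathlib
import Literature.Analysis.ODE.InverseSquareLadder
import Literature.Analysis.ODE.InverseCoordSmooth
import Literature.Analysis.PDE.InverseSquareLadderWave
import HarnessLib

/-!
# The Darboux ladder: locality in the coefficient, scaled smooth inverses, and the spatial
# intertwining identity `ladder ι n (f'') = (ladder ι n f)'' − n(n+1) ι² (ladder ι n f)`

Analysis/ODE support file (everything proved, no new definitions). Three small facts about the
ladder `ladder ι n = (∂ₓ − nι) ∘ ⋯ ∘ (∂ₓ − ι)` of `InverseSquareLadder.lean`:

* `ladder_eventuallyEq_of_iota` — the value of `ladder ι n f` near `x` depends on `ι` only near `x`;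
* `exists_smooth_inv_extension_Ici` — for every `c > 0` a smooth `ι` with `ι = x⁻¹` on `[c, ∞)`
  (and hence the Riccati relation `ι' = −ι²` on `(c, ∞)`), by rescaling
  `Literature.Analysis.ODE.exists_smooth_inv_extension`;
* `ladder_intertwine` — on an open set `S` where `ι' = −ι²`, for `f ∈ C^{n+3}`,
  `ladder ι n (f'') = (ladder ι n f)'' − n(n+1) ι² ladder ι n f`, i.e. the operator identity
  `L_n ∘ ∂² = (∂² − n(n+1)ι²) ∘ L_n` (the time-independent form of
  `Literature.Analysis.PDE.ladder_wave`, obtained from it through the even d'Alembert wave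
  `Φ(t,x) = (f(x+t) + f(x−t))/2`).
These serve the exact (`c = 1`) ladder isometry behind the odd-dimensional exterior-energy identity
with apex at the centre (Duyckaerts–Kenig–Merle; Kenig–Lawrie–Liu–Schlag 2015, §2), route
PhotonSphereChannels, item `WindowedShellChannels` (stmt-FinalStateConjecture-14085, far side).
Folklore.
-/

noncomputable section

namespace Literature.Analysis.ODE

open Set Filter Topology

variable {ι : ℝ → ℝ}

/-! ### Locality in the coefficient `ι` -/

/-- One rung only sees `ι` and `f` near the point. [folklore] -/
theorem ladderStep_eventuallyEq_of_iota {ι₁ ι₂ f₁ f₂ : ℝ → ℝ} {x : ℝ} (hι : ι₁ =ᶠ[𝓝 x] ι₂)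
    (hf : f₁ =ᶠ[𝓝 x] f₂) (k : ℕ) : ladderStep ι₁ k f₁ =ᶠ[𝓝 x] ladderStep ι₂ k f₂ := by
  have hd : deriv f₁ =ᶠ[𝓝 x] deriv f₂ := hf.deriv
  filter_upwards [hι, hf, hd] with y hy hfy hdy
  simp only [ladderStep_apply, hy, hfy, hdy]

/-- **Locality of the ladder in the coefficient**: if `ι₁ = ι₂` near `x` then
`ladder ι₁ n f = ladder ι₂ n f` near `x`. [folklore] -/
theorem ladder_eventuallyEq_of_iota {ι₁ ι₂ : ℝ → ℝ} {x : ℝ} (hι : ι₁ =ᶠ[𝓝 x] ι₂) (n : ℕ)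
    (f : ℝ → ℝ) : ladder ι₁ n f =ᶠ[𝓝 x] ladder ι₂ n f := by
  induction n with
  | zero => exact Filter.Eventually.of_forall fun _ => rfl
  | succ n ih =>
    rw [ladder_succ, ladder_succ]
    -- upgrade the hypotheses to a neighbourhood on which they hold everywhere
    have hι' : ∀ᶠ y in 𝓝 x, ι₁ =ᶠ[𝓝 y] ι₂ := hι.eventually_nhds
    have ih' : ∀ᶠ y in 𝓝 x, ladder ι₁ n f =ᶠ[𝓝 y] ladder ι₂ n f := ih.eventually_nhds
    filter_upwards [hι', ih'] with y hy hfy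
    exact (ladderStep_eventuallyEq_of_iota hy hfy (n + 1)).eq_of_nhds

/-- Pointwise form: `ι₁ = ι₂` on an open set `U` ⇒ `ladder ι₁ n f = ladder ι₂ n f` on `U`.
[folklore] -/
theorem ladder_congr_of_eqOn_iota {ι₁ ι₂ : ℝ → ℝ} {U : Set ℝ} (hU : IsOpen U)
    (h : ∀ y ∈ U, ι₁ y = ι₂ y) (n : ℕ) (f : ℝ → ℝ) {x : ℝ} (hx : x ∈ U) :
    ladder ι₁ n f x = ladder ι₂ n f x := by
  have hι : ι₁ =ᶠ[𝓝 x] ι₂ := Filter.mem_of_superset (hU.mem_nhds hx) fun y hy => h y hy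
  exact (ladder_eventuallyEq_of_iota hι n f).eq_of_nhds

/-! ### Smooth coefficients equal to `x⁻¹` on `[c, ∞)` -/

/-- **Scaled smooth inverse**: for `c > 0` there is a smooth `ι` with `ι = x⁻¹` on `[c, ∞)` and
`ι' = −ι²` on `(c, ∞)`. [folklore] -/
theorem exists_smooth_inv_extension_Ici {c : ℝ} (hc : 0 < c) :
    ∃ ι : ℝ → ℝ, ContDiff ℝ (⊤ : ℕ∞) ι ∧ (∀ x : ℝ, c ≤ x → ι x = x⁻¹) ∧
      ∀ x ∈ Ioi c, deriv ι x = -(ι x) ^ 2 := by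
  obtain ⟨ι₀, hι₀, hι₀eq, -, -⟩ := exists_smooth_inv_extension
  refine ⟨fun x => (2 * c)⁻¹ * ι₀ (x / (2 * c)), ?_, ?_, ?_⟩
  · exact contDiff_const.mul (hι₀.comp (contDiff_id.div_const _))
  · intro x hx
    have h2c : 0 < 2 * c := by positivity
    have hx' : 1 / 2 ≤ x / (2 * c) := by
      rw [le_div_iff₀ h2c]; linarith
    show (2 * c)⁻¹ * ι₀ (x / (2 * c)) = x⁻¹
    rw [hι₀eq _ hx', inv_div]
    field_simp
  · intro x hx
    have hx' : c < x := hx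
    have hx0 : x ≠ 0 := by intro h; rw [h] at hx'; linarith
    have h2c : 0 < 2 * c := by positivity
    have hev : (fun y => (2 * c)⁻¹ * ι₀ (y / (2 * c))) =ᶠ[𝓝 x] fun y => y⁻¹ := by
      filter_upwards [Ioi_mem_nhds hx'] with y hy
      have hcy : c < y := hy
      have hy' : 1 / 2 ≤ y / (2 * c) := by
        rw [le_div_iff₀ h2c]; linarith
      rw [hι₀eq _ hy', inv_div]
      field_simp
    have hself : (2 * c)⁻¹ * ι₀ (x / (2 * c)) = x⁻¹ := by
      have := hev.eq_of_nhds
      simpa using this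
    show deriv (fun y => (2 * c)⁻¹ * ι₀ (y / (2 * c))) x = -((2 * c)⁻¹ * ι₀ (x / (2 * c))) ^ 2
    rw [hev.deriv_eq, deriv_inv, hself]
    field_simp

/-! ### The spatial intertwining identity -/

/-- Joint smoothness of the even d'Alembert wave `(t,x) ↦ (f(x+t) + f(x−t))/2`. [folklore] -/
theorem contDiff_evenDAlembert {m : ℕ∞} {f : ℝ → ℝ} (hf : ContDiff ℝ m f) :
    ContDiff ℝ m (Function.uncurry fun t x => (f (x + t) + f (x - t)) / 2) := by
  have h1 : ContDiff ℝ m fun p : ℝ × ℝ => f (p.2 + p.1) := hf.comp (contDiff_snd.add contDiff_fst)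
  have h2 : ContDiff ℝ m fun p : ℝ × ℝ => f (p.2 - p.1) := hf.comp (contDiff_snd.sub contDiff_fst)
  exact (h1.add h2).div_const 2

/-- Time derivative of the even d'Alembert wave. [folklore] -/
theorem hasDerivAt_evenDAlembert_fst {f : ℝ → ℝ} (hf : Differentiable ℝ f) (t x : ℝ) :
    HasDerivAt (fun τ => (f (x + τ) + f (x - τ)) / 2)
      ((deriv f (x + t) - deriv f (x - t)) / 2) t := by
  have h1 : HasDerivAt (fun τ => f (x + τ)) (deriv f (x + t)) t :=
    (hf (x + t)).hasDerivAt.comp_const_add x t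
  have h2 : HasDerivAt (fun τ => f (x - τ)) (-deriv f (x - t)) t :=
    (hf (x - t)).hasDerivAt.comp_const_sub x t
  exact ((h1.fun_add h2).div_const 2).congr_deriv (by ring)

/-- Second space derivative of the even d'Alembert wave. [folklore] -/
theorem iteratedDeriv_two_evenDAlembert_snd {f : ℝ → ℝ} (hf : ContDiff ℝ 2 f) (t x : ℝ) :
    iteratedDeriv 2 (fun y => (f (y + t) + f (y - t)) / 2) x
      = (iteratedDeriv 2 f (x + t) + iteratedDeriv 2 f (x - t)) / 2 := by
  have hfd : Differentiable ℝ f := hf.differentiable (by norm_num)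
  have hfd' : Differentiable ℝ (deriv f) := by
    have := (contDiff_succ_iff_deriv.1 (show ContDiff ℝ (1 + 1) f from hf)).2.2
    exact this.differentiable (by norm_num)
  have hder1 : ∀ y, deriv (fun y => (f (y + t) + f (y - t)) / 2) y
      = (deriv f (y + t) + deriv f (y - t)) / 2 := by
    intro y
    have h1 : HasDerivAt (fun y => f (y + t)) (deriv f (y + t)) y :=
      (hfd (y + t)).hasDerivAt.comp_add_const y t
    have h2 : HasDerivAt (fun y => f (y - t)) (deriv f (y - t)) y :=
      (hfd (y - t)).hasDerivAt.comp_sub_const y t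
    exact ((h1.fun_add h2).div_const 2).deriv
  rw [iteratedDeriv_succ, iteratedDeriv_one]
  have e : deriv (fun y => (f (y + t) + f (y - t)) / 2)
      = fun y => (deriv f (y + t) + deriv f (y - t)) / 2 := funext hder1
  rw [e]
  have h1 : HasDerivAt (fun y => deriv f (y + t)) (iteratedDeriv 2 f (x + t)) x := by
    rw [iteratedDeriv_succ, iteratedDeriv_one]
    exact (hfd' (x + t)).hasDerivAt.comp_add_const x t
  have h2 : HasDerivAt (fun y => deriv f (y - t)) (iteratedDeriv 2 f (x - t)) x := by
    rw [iteratedDeriv_succ, iteratedDeriv_one]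
    exact (hfd' (x - t)).hasDerivAt.comp_sub_const x t
  exact ((h1.fun_add h2).div_const 2).deriv

/-- Second time derivative of the even d'Alembert wave. [folklore] -/
theorem iteratedDeriv_two_evenDAlembert_fst {f : ℝ → ℝ} (hf : ContDiff ℝ 2 f) (t x : ℝ) :
    iteratedDeriv 2 (fun τ => (f (x + τ) + f (x - τ)) / 2) t
      = (iteratedDeriv 2 f (x + t) + iteratedDeriv 2 f (x - t)) / 2 := by
  have hfd : Differentiable ℝ f := hf.differentiable (by norm_num)
  have hfd' : Differentiable ℝ (deriv f) := by
    have := (contDiff_succ_iff_deriv.1 (show ContDiff ℝ (1 + 1) f from hf)).2.2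
    exact this.differentiable (by norm_num)
  rw [iteratedDeriv_succ, iteratedDeriv_one]
  have e : deriv (fun τ => (f (x + τ) + f (x - τ)) / 2)
      = fun τ => (deriv f (x + τ) - deriv f (x - τ)) / 2 :=
    funext fun τ => (hasDerivAt_evenDAlembert_fst hfd τ x).deriv
  rw [e]
  have h1 : HasDerivAt (fun τ => deriv f (x + τ)) (iteratedDeriv 2 f (x + t)) t := by
    rw [iteratedDeriv_succ, iteratedDeriv_one]
    exact (hfd' (x + t)).hasDerivAt.comp_const_add x t
  have h2 : HasDerivAt (fun τ => deriv f (x - τ)) (-iteratedDeriv 2 f (x - t)) t := by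
    rw [iteratedDeriv_succ, iteratedDeriv_one]
    exact (hfd' (x - t)).hasDerivAt.comp_const_sub x t
  rw [((h1.fun_sub h2).div_const 2).deriv]
  ring

/-- **Spatial intertwining along the ladder.** On an open set `S` where `ι' = −ι²`, for
`f ∈ C^{n+3}`: `ladder ι n (f'') (x) = (ladder ι n f)'' (x) − n(n+1) ι(x)² ladder ι n f (x)`, `x ∈ S`.
[cite: KenigEtAl2015, §2] -/
theorem ladder_intertwine (hι : ContDiff ℝ (⊤ : ℕ∞) ι) {S : Set ℝ} (hS : IsOpen S)
    (hι' : ∀ x ∈ S, deriv ι x = -(ι x) ^ 2) {n : ℕ} {f : ℝ → ℝ}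
    (hf : ContDiff ℝ ((n + 3 : ℕ) : ℕ∞) f) {x : ℝ} (hx : x ∈ S) :
    ladder ι n (fun y => iteratedDeriv 2 f y) x
      = iteratedDeriv 2 (ladder ι n f) x - n * (n + 1) * ι x ^ 2 * ladder ι n f x := by
  -- the even d'Alembert wave through `f`
  set Φ : ℝ → ℝ → ℝ := fun t y => (f (y + t) + f (y - t)) / 2 with hΦ
  have hΦC : ContDiff ℝ ((n + 3 : ℕ) : ℕ∞) (Function.uncurry Φ) := contDiff_evenDAlembert hf
  have hΦC2 : ContDiff ℝ ((n + 2 : ℕ) : ℕ∞) (Function.uncurry Φ) :=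
    hΦC.of_le (by exact_mod_cast Nat.le_succ _)
  have h2le : ((2 : ℕ) : ℕ∞) ≤ ((n + 3 : ℕ) : ℕ∞) := by exact_mod_cast (by omega : 2 ≤ n + 3)
  have hf2 : ContDiff ℝ 2 f := hf.of_le (WithTop.coe_le_coe.mpr h2le)
  have hfree : ∀ t y, iteratedDeriv 2 (fun τ => Φ τ y) t = iteratedDeriv 2 (Φ t) y := by
    intro t y
    show iteratedDeriv 2 (fun τ => (f (y + τ) + f (y - τ)) / 2) t
      = iteratedDeriv 2 (fun z => (f (z + t) + f (z - t)) / 2) y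
    rw [iteratedDeriv_two_evenDAlembert_fst hf2, iteratedDeriv_two_evenDAlembert_snd hf2]
  obtain ⟨-, hsol⟩ := Literature.Analysis.PDE.ladder_wave hι hS hι' (n := n) hΦC2 hfree
  have key := hsol 0 x hx
  -- `Φ 0 = f`
  have hΦ0 : Φ 0 = f := by
    funext y; show (f (y + 0) + f (y - 0)) / 2 = f y; rw [add_zero, sub_zero]; ring
  rw [hΦ0] at key
  -- the left-hand side of `key` is `ladder ι n (f'')`
  -- first time derivative: the odd wave `Ψ(t,y) = (f'(y+t) − f'(y−t))/2`
  set Ψ : ℝ → ℝ → ℝ := fun t y => (deriv f (y + t) - deriv f (y - t)) / 2 with hΨ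
  have hfd : Differentiable ℝ f := hf2.differentiable (by norm_num)
  have hdf : ContDiff ℝ ((n + 2 : ℕ) : ℕ∞) (deriv f) := by
    have h := (contDiff_succ_iff_deriv.1
      (show ContDiff ℝ ((((n + 2 : ℕ) : ℕ∞) : WithTop ℕ∞) + 1) f by exact_mod_cast hf)).2.2
    exact_mod_cast h
  have hΨC : ContDiff ℝ ((n + 2 : ℕ) : ℕ∞) (Function.uncurry Ψ) := by
    have h1 : ContDiff ℝ ((n + 2 : ℕ) : ℕ∞) fun p : ℝ × ℝ => deriv f (p.2 + p.1) :=
      hdf.comp (contDiff_snd.add contDiff_fst)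
    have h2 : ContDiff ℝ ((n + 2 : ℕ) : ℕ∞) fun p : ℝ × ℝ => deriv f (p.2 - p.1) :=
      hdf.comp (contDiff_snd.sub contDiff_fst)
    exact (h1.sub h2).div_const 2
  have hΦt : ∀ t y, deriv (fun τ => Φ τ y) t = Ψ t y := fun t y =>
    (hasDerivAt_evenDAlembert_fst hfd t y).deriv
  have hstep1 : deriv (fun s => ladder ι n (Φ s) x) = fun τ => ladder ι n (Ψ τ) x := by
    funext τ
    rw [Literature.Analysis.PDE.deriv_ladder_param hι hΦC2 τ x]
    congr 1
    funext y
    exact hΦt τ y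
  have hdf1 : Differentiable ℝ (deriv f) := by
    have h := (contDiff_succ_iff_deriv.1 (show ContDiff ℝ (1 + 1) f from hf2)).2.2
    exact h.differentiable (by norm_num)
  have hΨt0 : ∀ y, deriv (fun τ => Ψ τ y) 0 = iteratedDeriv 2 f y := by
    intro y
    have h1 : HasDerivAt (fun τ => deriv f (y + τ)) (iteratedDeriv 2 f y) 0 := by
      rw [iteratedDeriv_succ, iteratedDeriv_one]
      have := (hdf1 (y + 0)).hasDerivAt.comp_const_add y 0
      simpa using this
    have h2 : HasDerivAt (fun τ => deriv f (y - τ)) (-iteratedDeriv 2 f y) 0 := by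
      rw [iteratedDeriv_succ, iteratedDeriv_one]
      have := (hdf1 (y - 0)).hasDerivAt.comp_const_sub y 0
      simpa using this
    have h3 := ((h1.fun_sub h2).div_const 2).deriv
    show deriv (fun τ => (deriv f (y + τ) - deriv f (y - τ)) / 2) 0 = iteratedDeriv 2 f y
    rw [h3]; ring
  have hlhs : iteratedDeriv 2 (fun τ => ladder ι n (Φ τ) x) 0
      = ladder ι n (fun y => iteratedDeriv 2 f y) x := by
    rw [iteratedDeriv_succ, iteratedDeriv_one, hstep1,
      Literature.Analysis.PDE.deriv_ladder_param hι hΨC 0 x]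
    congr 1
    funext y
    exact hΨt0 y
  rw [hlhs] at key
  exact key

end Literature.Analysis.ODE
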